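import Literature.MeasureTheory.Radon.WeakSequentialCompletenessHumps
import Mathlib.MeasureTheory.Integral.Bochner.Set
import Mathlib.MeasureTheory.Integral.BoundedContinuousFunction
import Mathlib.Analysis.SpecificLimits.Basic
import HarnessLib


/-!
# Weak sequential completeness of `P(X)`, `X` Polish — II: observable-wise convergence forces tightness

Topic `MeasureTheory/Radon`; namespace `Literature.MeasureTheory.Radon`.  The tightness half of the
classical weak sequential completeness theorem (A. D. Alexandroff 1943; V. S. Varadarajan, Mat. Sb. 55
(1961), Part II; V. I. Bogachev, *Measure Theory* II, §8.7): on a complete separable metric space `X`, if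
`μₙ` are Borel probability measures such that `∫ f dμₙ` converges in `ℝ` for EVERY bounded continuous
`f : X → ℝ`, then

* `exists_finite_forall_measure_compl_le` — for every `ε > 0` and `r > 0` finitely many `r`-balls carry all
  but `ε` of the mass of every `μₙ` (the gliding hump: with the humps of `exists_humps`, the trapezoid `f`
  of `⋃_{k even} G_k` has `∫ f dμ_{n_k} ≥ Λ_k + 3ε/8` for even `k` and `≤ Λ_k + ε/4` for odd `k`, where
  `Λ_k = Σ_{i<k even} L ψ_i` increases to a finite limit — so `∫ f dμₙ` would not converge);
* `isTightMeasureSet_range_of_forall_tendsto_integral` — the sequence `(μₙ)` is uniformly TIGHT.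

The representation of the limit functional by a probability measure and the filter form are in
`WeakSequentialCompleteness`.  Everything proved, standard axioms. [folklore]
-/

noncomputable section

open MeasureTheory Filter Topology Set Metric Function
open scoped ENNReal NNReal BoundedContinuousFunction Topology

namespace Literature.MeasureTheory.Radon

variable {X : Type*} [PseudoMetricSpace X] [MeasurableSpace X] [BorelSpace X]

/-- **The gliding hump.**  On a complete separable metric space, let `μₙ` be Borel probability measures such
that `∫ f dμₙ` converges for every bounded continuous `f`.  Then for every `ε > 0` and `r > 0` finitely many
`r`-balls carry all but `ε` of the mass of EVERY `μₙ`.  Otherwise take the humps `n_j, G_j` of `exists_humps`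
(tolerances `η_j = ε/16/2^j`) and the trapezoid `f` of `⋃_{k even} G_k`: `∫ f dμ_{n_k} ≥ Λ_k + 3ε/8` for even
`k` and `≤ Λ_k + ε/4` for odd `k`, where `Λ_k = Σ_{i<k even} L(ψ_i)` increases to a finite limit — so
`∫ f dμₙ` does not converge, a contradiction. [folklore] -/
theorem exists_finite_forall_measure_compl_le [CompleteSpace X] [SecondCountableTopology X]
    {μ : ℕ → Measure X} [∀ n, IsProbabilityMeasure (μ n)]
    (h : ∀ f : X →ᵇ ℝ, ∃ L : ℝ, Tendsto (fun n => ∫ x, f x ∂μ n) atTop (𝓝 L))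
    {ε : ℝ} (hε : 0 < ε) {r : ℝ} (hr : 0 < r) :
    ∃ F : Set X, F.Finite ∧ ∀ n, μ n (⋃ x ∈ F, ball x r)ᶜ ≤ ENNReal.ofReal ε := by
  classical
  by_contra hcon
  push Not at hcon
  choose L hL using h
  -- tolerances `η j = ε/16/2^j`, summing to `ε/8`
  set η : ℕ → ℝ := fun j => ε / 16 / 2 ^ j with hη
  have hηpos : ∀ j, 0 < η j := fun j => by positivity
  have hηle : ∀ j, η j ≤ ε := fun j => by
    have h1 : ε / 16 / 2 ^ j ≤ ε / 16 := div_le_self (by positivity) (one_le_pow₀ (by norm_num))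
    show ε / 16 / 2 ^ j ≤ ε
    linarith
  have hηsum : HasSum η (ε / 8) := by
    have := hasSum_geometric_two' (ε / 8)
    convert this using 1
    funext j
    show ε / 16 / 2 ^ j = ε / 8 / 2 / 2 ^ j
    ring
  -- the trapezoid test function of a set of centres: `1` on the `r/8`-neighbourhood, `0` off the
  -- `r/4`-neighbourhood, affine in `infDist` in between
  have hbound : ∀ (s : Set X) (x y : X), dist (min 1 (max 0 (2 - 8 / r * infDist x s)))
      (min 1 (max 0 (2 - 8 / r * infDist y s))) ≤ 1 := by
    intro s x y
    rw [Real.dist_eq, abs_sub_le_iff]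
    constructor <;>
    nlinarith [min_le_left (1 : ℝ) (max 0 (2 - 8 / r * infDist x s)),
      min_le_left (1 : ℝ) (max 0 (2 - 8 / r * infDist y s)),
      le_min zero_le_one (le_max_left (0 : ℝ) (2 - 8 / r * infDist x s)),
      le_min zero_le_one (le_max_left (0 : ℝ) (2 - 8 / r * infDist y s))]
  set Φ : Set X → (X →ᵇ ℝ) := fun s => BoundedContinuousFunction.mkOfBound
    ⟨fun x => min 1 (max 0 (2 - 8 / r * infDist x s)),
      continuous_const.min (continuous_const.max
        (continuous_const.sub (continuous_const.mul (continuous_infDist_pt s))))⟩ 1 (hbound s) with hΦ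
  have hΦapply : ∀ (s : Set X) (x : X), Φ s x = min 1 (max 0 (2 - 8 / r * infDist x s)) := fun s x => rfl
  have hΦnn : ∀ (s : Set X) (x : X), 0 ≤ Φ s x := fun s x => by
    rw [hΦapply]; exact le_min zero_le_one (le_max_left _ _)
  have hΦle : ∀ (s : Set X) (x : X), Φ s x ≤ 1 := fun s x => by rw [hΦapply]; exact min_le_left _ _
  have hΦone : ∀ (s : Set X) (x : X), infDist x s < r / 8 → Φ s x = 1 := by
    intro s x hx
    rw [hΦapply]
    have h1 : 8 / r * infDist x s < 1 := by
      rw [div_mul_eq_mul_div, div_lt_one hr]; linarith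
    exact min_eq_left (le_max_of_le_right (by linarith))
  have hΦzero : ∀ (s : Set X) (x : X), r / 4 ≤ infDist x s → Φ s x = 0 := by
    intro s x hx
    rw [hΦapply]
    have h1 : 2 ≤ 8 / r * infDist x s := by
      rw [div_mul_eq_mul_div, le_div_iff₀ hr]; linarith
    rw [max_eq_left (by linarith), min_eq_right zero_le_one]
  have hΦsupp : ∀ (s : Set X) (x : X), Φ s x ≠ 0 → infDist x s < r / 4 := by
    intro s x hx
    by_contra h'
    exact hx (hΦzero s x (not_lt.1 h'))
  have hΦanti : ∀ (s t : Set X) (x : X), infDist x t ≤ infDist x s → Φ s x ≤ Φ t x := by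
    intro s t x hle
    rw [hΦapply, hΦapply]
    have : 8 / r * infDist x t ≤ 8 / r * infDist x s :=
      mul_le_mul_of_nonneg_left hle (div_nonneg (by norm_num) hr.le)
    exact min_le_min le_rfl (max_le_max le_rfl (by linarith))
  -- the humps
  obtain ⟨nn, G, hnmono, hGne, hfar, hhump, hinvis, hconv⟩ := exists_humps hL Φ hε hr hηpos hηle hcon
  set W : Set X → Set X := fun G => ⋃ y ∈ G, ball y (r / 8) with hW
  set V : Set X → Set X := fun G => ⋃ y ∈ G, ball y (r / 4) with hV
  set ψ : ℕ → X →ᵇ ℝ := fun j => Φ (G j) with hψ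
  change ∀ j, ENNReal.ofReal (ε / 2) < μ (nn j) (W (G j)) at hhump
  change ∀ i j, i < j → μ (nn i) (V (G j)) ≤ ENNReal.ofReal (η j) at hinvis
  change ∀ i j, i < j → |∫ x, ψ i x ∂μ (nn j) - L (ψ i)| ≤ η i at hconv
  -- geometry of the neighbourhoods
  have hW_sub_V : ∀ j, W (G j) ⊆ V (G j) := fun j x hx => by
    obtain ⟨y, hy, hxy⟩ := mem_iUnion₂.1 hx
    exact mem_biUnion hy (ball_subset_ball (by linarith) hxy)
  have hVdisj : ∀ i j, i ≠ j → ∀ x, x ∈ V (G i) → x ∉ V (G j) := by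
    intro i j hij x hxi hxj
    obtain ⟨y, hy, hxy⟩ := mem_iUnion₂.1 hxi
    obtain ⟨y', hy', hxy'⟩ := mem_iUnion₂.1 hxj
    rw [mem_ball] at hxy hxy'
    have h1 := hfar i j hij y hy y' hy'
    have h2 := dist_triangle y x y'
    rw [dist_comm] at hxy
    linarith
  have hVopen : ∀ s : Set X, IsOpen (V s) := fun s => isOpen_biUnion fun _ _ => isOpen_ball
  have hWopen : ∀ s : Set X, IsOpen (W s) := fun s => isOpen_biUnion fun _ _ => isOpen_ball
  -- support of `ψ j` lies in `V (G j)`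
  have hψsupp : ∀ j x, ψ j x ≠ 0 → x ∈ V (G j) := by
    intro j x hx
    have hlt := hΦsupp _ x hx
    obtain ⟨y, hy, hxy⟩ := (infDist_lt_iff (hGne j)).1 hlt
    exact mem_biUnion hy (mem_ball.2 hxy)
  have hψnn : ∀ j x, 0 ≤ ψ j x := fun j x => hΦnn _ _
  have hψle : ∀ j x, ψ j x ≤ 1 := fun j x => hΦle _ _
  -- the test function: trapezoid of the even humps
  set S : Set X := ⋃ j, ⋃ (_ : Even j), G j with hS
  have hGS : ∀ j, Even j → G j ⊆ S := fun j hj x hx => mem_iUnion.2 ⟨j, mem_iUnion.2 ⟨hj, hx⟩⟩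
  have hSne : S.Nonempty := (hGne 0).mono (hGS 0 ⟨0, rfl⟩)
  set f : X →ᵇ ℝ := Φ S with hf
  have hψ_le_f : ∀ j, Even j → ∀ x, ψ j x ≤ f x := fun j hj x =>
    hΦanti _ _ x (infDist_le_infDist_of_subset (hGS j hj) (hGne j))
  have hf_one : ∀ j, Even j → ∀ x ∈ W (G j), f x = 1 := by
    intro j hj x hx
    obtain ⟨y, hy, hxy⟩ := mem_iUnion₂.1 hx
    exact hΦone _ x ((infDist_le_dist_of_mem (hGS j hj hy)).trans_lt (mem_ball.1 hxy))
  have hf_cases : ∀ x, f x ≠ 0 → ∃ j, Even j ∧ x ∈ V (G j) ∧ f x = ψ j x := by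
    intro x hx
    have hlt := hΦsupp _ x hx
    obtain ⟨s, hs, hxs⟩ := (infDist_lt_iff hSne).1 hlt
    obtain ⟨j, hj⟩ := mem_iUnion.1 hs
    obtain ⟨hje, hsG⟩ := mem_iUnion.1 hj
    refine ⟨j, hje, mem_biUnion hsG (mem_ball.2 hxs), le_antisymm ?_ (hψ_le_f j hje x)⟩
    -- `infDist x (G j) ≤ infDist x S`, by separation
    refine hΦanti _ _ x ?_
    by_contra hlt'
    push Not at hlt'
    obtain ⟨s', hs', hxs'⟩ := (infDist_lt_iff hSne).1 hlt'
    obtain ⟨i, hi⟩ := mem_iUnion.1 hs'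
    obtain ⟨-, hs'G⟩ := mem_iUnion.1 hi
    rcases eq_or_ne i j with rfl | hij
    · exact (lt_irrefl _) (hxs'.trans_le (infDist_le_dist_of_mem hs'G))
    · have h1 := hfar j i hij.symm s hsG s' hs'G
      have h2 := dist_triangle s x s'
      have h3 : infDist x (G j) ≤ dist x s := infDist_le_dist_of_mem hsG
      linarith [infDist_nonneg (x := x) (s := G j), dist_comm s x]
  have hfnn : ∀ x, 0 ≤ f x := fun x => hΦnn _ _
  have hfle : ∀ x, f x ≤ 1 := fun x => hΦle _ _
  -- partial sums over the even humps below `k`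
  set J : ℕ → Finset ℕ := fun k => (Finset.range k).filter Even with hJ
  have hJmem : ∀ {k j}, j ∈ J k ↔ j < k ∧ Even j := fun {k j} => by
    simp [hJ, Finset.mem_filter, Finset.mem_range]
  -- at most one `ψ j` is nonzero at a point: the finite sums are `≤ 1` and single out one term
  have hsum_single : ∀ (k : ℕ) (x : X) (j : ℕ), j ∈ J k → ψ j x ≠ 0 →
      ∑ i ∈ J k, ψ i x = ψ j x := by
    intro k x j hj hx
    refine Finset.sum_eq_single_of_mem j hj fun i _ hij => ?_
    by_contra hne
    exact hVdisj i j hij x (hψsupp i x hne) (hψsupp j x hx)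
  have hsum_le_one : ∀ (k : ℕ) (x : X), ∑ i ∈ J k, ψ i x ≤ 1 := by
    intro k x
    by_cases hex : ∃ j ∈ J k, ψ j x ≠ 0
    · obtain ⟨j, hj, hx⟩ := hex
      rw [hsum_single k x j hj hx]
      exact hψle j x
    · push Not at hex
      rw [Finset.sum_eq_zero hex]
      exact zero_le_one
  have hsum_nn : ∀ (k : ℕ) (x : X), 0 ≤ ∑ i ∈ J k, ψ i x :=
    fun k x => Finset.sum_nonneg fun i _ => hψnn i x
  -- integrability facts
  have hint : ∀ (g : X →ᵇ ℝ) (n : ℕ), Integrable g (μ n) := fun g n => g.integrable _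
  have hintsum : ∀ (k n : ℕ), Integrable (fun x => ∑ i ∈ J k, ψ i x) (μ n) := fun k n =>
    integrable_finsetSum _ fun i _ => hint (ψ i) n
  -- LOWER bound at even `k`
  have hlow : ∀ k, Even k →
      (∑ i ∈ J k, ∫ x, ψ i x ∂μ (nn k)) + (μ (nn k) (W (G k))).toReal ≤ ∫ x, f x ∂μ (nn k) := by
    intro k hk
    have hmeas : MeasurableSet (W (G k)) := (hWopen _).measurableSet
    have hpt : ∀ x, (∑ i ∈ J k, ψ i x) + (W (G k)).indicator (fun _ => (1 : ℝ)) x ≤ f x := by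
      intro x
      by_cases hxW : x ∈ W (G k)
      · have hzero : ∑ i ∈ J k, ψ i x = 0 := by
          refine Finset.sum_eq_zero fun i hi => ?_
          by_contra hne
          have hik : i ≠ k := (hJmem.1 hi).1.ne
          exact hVdisj i k hik x (hψsupp i x hne) (hW_sub_V k hxW)
        rw [hzero, indicator_of_mem hxW, hf_one k hk x hxW]
        simp
      · rw [indicator_of_notMem hxW, add_zero]
        by_cases hex : ∃ j ∈ J k, ψ j x ≠ 0
        · obtain ⟨j, hj, hx⟩ := hex
          rw [hsum_single k x j hj hx]
          exact hψ_le_f j (hJmem.1 hj).2 x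
        · push Not at hex
          rw [Finset.sum_eq_zero hex]
          exact hfnn x
    have h1 : ∫ x, (∑ i ∈ J k, ψ i x) + (W (G k)).indicator (fun _ => (1 : ℝ)) x ∂μ (nn k) ≤
        ∫ x, f x ∂μ (nn k) :=
      integral_mono ((hintsum k _).add ((integrable_const (1 : ℝ)).indicator hmeas)) (hint f _) hpt
    have h2 : ∫ x, (∑ i ∈ J k, ψ i x) + (W (G k)).indicator (fun _ => (1 : ℝ)) x ∂μ (nn k) =
        (∑ i ∈ J k, ∫ x, ψ i x ∂μ (nn k)) + (μ (nn k) (W (G k))).toReal := by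
      rw [integral_add (hintsum k _) ((integrable_const (1 : ℝ)).indicator hmeas),
        integral_finsetSum _ (fun i _ => hint (ψ i) _), integral_indicator_const _ hmeas,
        measureReal_def, smul_eq_mul, mul_one]
    linarith
  -- UPPER bound at odd `k`
  set R : ℕ → Set X := fun k => ⋃ j, ⋃ (_ : Even j ∧ k < j), V (G j) with hR
  have hRopen : ∀ k, IsOpen (R k) := fun k => isOpen_iUnion fun j => isOpen_iUnion fun _ => hVopen _
  have hupp : ∀ k, ¬ Even k →
      ∫ x, f x ∂μ (nn k) ≤ (∑ i ∈ J k, ∫ x, ψ i x ∂μ (nn k)) + (μ (nn k) (R k)).toReal := by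
    intro k hk
    have hmeas : MeasurableSet (R k) := (hRopen k).measurableSet
    have hpt : ∀ x, f x ≤ (∑ i ∈ J k, ψ i x) + (R k).indicator (fun _ => (1 : ℝ)) x := by
      intro x
      by_cases hfx : f x = 0
      · rw [hfx]
        exact add_nonneg (hsum_nn k x) (indicator_nonneg (fun _ _ => zero_le_one) _)
      · obtain ⟨j, hje, hxV, hfψ⟩ := hf_cases x hfx
        have hjk : j ≠ k := fun h => hk (h ▸ hje)
        rcases lt_or_gt_of_ne hjk with hlt | hgt
        · rw [hfψ]
          have hj : j ∈ J k := hJmem.2 ⟨hlt, hje⟩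
          exact (Finset.single_le_sum (fun i _ => hψnn i x) hj).trans
            (le_add_of_nonneg_right (indicator_nonneg (fun _ _ => zero_le_one) _))
        · have hxR : x ∈ R k := mem_iUnion.2 ⟨j, mem_iUnion.2 ⟨⟨hje, hgt⟩, hxV⟩⟩
          rw [indicator_of_mem hxR]
          simpa using (hfle x).trans (le_add_of_nonneg_left (hsum_nn k x))
    have h1 : ∫ x, f x ∂μ (nn k) ≤
        ∫ x, (∑ i ∈ J k, ψ i x) + (R k).indicator (fun _ => (1 : ℝ)) x ∂μ (nn k) :=
      integral_mono (hint f _) ((hintsum k _).add ((integrable_const (1 : ℝ)).indicator hmeas)) hpt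
    have h2 : ∫ x, (∑ i ∈ J k, ψ i x) + (R k).indicator (fun _ => (1 : ℝ)) x ∂μ (nn k) =
        (∑ i ∈ J k, ∫ x, ψ i x ∂μ (nn k)) + (μ (nn k) (R k)).toReal := by
      rw [integral_add (hintsum k _) ((integrable_const (1 : ℝ)).indicator hmeas),
        integral_finsetSum _ (fun i _ => hint (ψ i) _), integral_indicator_const _ hmeas,
        measureReal_def, smul_eq_mul, mul_one]
    linarith
  -- the remainder `R k` is nearly invisible to `μ (nn k)`
  have hRsmall : ∀ k, (μ (nn k) (R k)).toReal ≤ ε / 8 := by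
    intro k
    refine ENNReal.toReal_le_of_le_ofReal (by positivity) ?_
    have hpiece : ∀ j, μ (nn k) (⋃ (_ : Even j ∧ k < j), V (G j)) ≤ ENNReal.ofReal (η j) := by
      intro j
      by_cases hp : Even j ∧ k < j
      · haveI : Nonempty (Even j ∧ k < j) := ⟨hp⟩
        rw [iUnion_const]
        exact hinvis k j hp.2
      · haveI : IsEmpty (Even j ∧ k < j) := ⟨hp⟩
        rw [iUnion_of_empty, measure_empty]
        exact bot_le
    calc μ (nn k) (R k) ≤ ∑' j, μ (nn k) (⋃ (_ : Even j ∧ k < j), V (G j)) := measure_iUnion_le _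
      _ ≤ ∑' j, ENNReal.ofReal (η j) := ENNReal.tsum_le_tsum hpiece
      _ = ENNReal.ofReal (∑' j, η j) :=
          (ENNReal.ofReal_tsum_of_nonneg (fun j => (hηpos j).le) hηsum.summable).symm
      _ = ENNReal.ofReal (ε / 8) := by rw [hηsum.tsum_eq]
  -- the converged part: `Λ k = Σ_{i<k even} L (ψ i)`
  set Λ : ℕ → ℝ := fun k => ∑ i ∈ J k, L (ψ i) with hΛ
  have hclose : ∀ k, |(∑ i ∈ J k, ∫ x, ψ i x ∂μ (nn k)) - Λ k| ≤ ε / 8 := by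
    intro k
    rw [hΛ, ← Finset.sum_sub_distrib]
    refine (Finset.abs_sum_le_sum_abs _ _).trans ?_
    calc ∑ i ∈ J k, |∫ x, ψ i x ∂μ (nn k) - L (ψ i)| ≤ ∑ i ∈ J k, η i :=
          Finset.sum_le_sum fun i hi => hconv i k (hJmem.1 hi).1
      _ ≤ ε / 8 := sum_le_hasSum _ (fun i _ => (hηpos i).le) hηsum
  have hLnn : ∀ i, 0 ≤ L (ψ i) := fun i =>
    ge_of_tendsto' (hL (ψ i)) fun n => integral_nonneg fun x => hψnn i x
  have hΛmono : Monotone Λ := by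
    refine monotone_nat_of_le_succ fun k => Finset.sum_le_sum_of_subset_of_nonneg ?_ fun i _ _ => hLnn i
    intro i hi
    exact hJmem.2 ⟨(hJmem.1 hi).1.trans (Nat.lt_succ_self k), (hJmem.1 hi).2⟩
  have hΛle : ∀ k, Λ k ≤ 1 := by
    intro k
    have ht : Tendsto (fun n => ∑ i ∈ J k, ∫ x, ψ i x ∂μ n) atTop (𝓝 (Λ k)) :=
      tendsto_finsetSum _ fun i _ => hL (ψ i)
    refine le_of_tendsto' ht fun n => ?_
    rw [← integral_finsetSum _ (fun i _ => hint (ψ i) n)]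
    calc ∫ x, ∑ i ∈ J k, ψ i x ∂μ n ≤ ∫ _, (1 : ℝ) ∂μ n :=
          integral_mono (hintsum k n) (integrable_const 1) fun x => hsum_le_one k x
      _ = 1 := by simp
  have hΛbdd : BddAbove (range Λ) := ⟨1, by rintro _ ⟨k, rfl⟩; exact hΛle k⟩
  have hΛlim : Tendsto Λ atTop (𝓝 (⨆ k, Λ k)) := tendsto_atTop_ciSup hΛmono hΛbdd
  set Λl : ℝ := ⨆ k, Λ k with hΛl
  -- the integrals along the humps converge
  set u : ℕ → ℝ := fun k => ∫ x, f x ∂μ (nn k) with hu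
  have hulim : Tendsto u atTop (𝓝 (L f)) := (hL f).comp hnmono.tendsto_atTop
  -- even and odd subsequences
  have he2 : StrictMono fun i : ℕ => 2 * i := strictMono_nat_of_lt_succ fun i => by omega
  have ho2 : StrictMono fun i : ℕ => 2 * i + 1 := strictMono_nat_of_lt_succ fun i => by omega
  have heven : ∀ i : ℕ, Λ (2 * i) + 3 * ε / 8 ≤ u (2 * i) := by
    intro i
    have hk : Even (2 * i) := even_two_mul i
    have h1 := hlow (2 * i) hk
    have h2 := hclose (2 * i)
    have h3 : ε / 2 < (μ (nn (2 * i)) (W (G (2 * i)))).toReal :=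
      (ENNReal.ofReal_lt_iff_lt_toReal (by positivity) (measure_ne_top _ _)).1 (hhump (2 * i))
    rw [abs_le] at h2
    show Λ (2 * i) + 3 * ε / 8 ≤ ∫ x, f x ∂μ (nn (2 * i))
    linarith
  have hodd : ∀ i : ℕ, u (2 * i + 1) ≤ Λ (2 * i + 1) + ε / 4 := by
    intro i
    have hk : ¬ Even (2 * i + 1) := Nat.not_even_iff_odd.2 (odd_two_mul_add_one i)
    have h1 := hupp (2 * i + 1) hk
    have h2 := hclose (2 * i + 1)
    have h3 := hRsmall (2 * i + 1)
    rw [abs_le] at h2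
    show ∫ x, f x ∂μ (nn (2 * i + 1)) ≤ Λ (2 * i + 1) + ε / 4
    linarith
  have hlim1 : Λl + 3 * ε / 8 ≤ L f :=
    le_of_tendsto_of_tendsto' ((hΛlim.comp he2.tendsto_atTop).add_const _)
      (hulim.comp he2.tendsto_atTop) heven
  have hlim2 : L f ≤ Λl + ε / 4 :=
    le_of_tendsto_of_tendsto' (hulim.comp ho2.tendsto_atTop)
      ((hΛlim.comp ho2.tendsto_atTop).add_const _) hodd
  linarith

/-! ### Weak sequential completeness -/

/-- **Observable-wise convergence forces tightness** (Alexandroff–Varadarajan; Bogachev, *Measure Theory*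
II, §8.7).  On a complete separable metric space, a sequence of Borel probability measures along which
`∫ f dμₙ` converges for every bounded continuous `f` is uniformly tight. [folklore] -/
theorem isTightMeasureSet_range_of_forall_tendsto_integral [CompleteSpace X] [SecondCountableTopology X]
    {μ : ℕ → Measure X} [∀ n, IsProbabilityMeasure (μ n)]
    (h : ∀ f : X →ᵇ ℝ, ∃ L : ℝ, Tendsto (fun n => ∫ x, f x ∂μ n) atTop (𝓝 L)) :
    IsTightMeasureSet (Set.range μ) := by
  refine isTightMeasureSet_of_forall_exists_finite_cover fun ε hε r hr => ?_
  rcases eq_or_ne ε ∞ with rfl | hεtop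
  · exact ⟨∅, finite_empty, fun μ' _ => le_top⟩
  obtain ⟨F, hF, hFμ⟩ := exists_finite_forall_measure_compl_le h (ENNReal.toReal_pos hε.ne' hεtop) hr
  refine ⟨F, hF, ?_⟩
  rintro _ ⟨n, rfl⟩
  exact (hFμ n).trans (ENNReal.ofReal_toReal hεtop).le

end Literature.MeasureTheory.Radon

end
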